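import Literature.MathematicalPhysics.QuantumFieldTheory.Balaban1983to89.T4ShellMeasureAnalytic

/-!
# `T4Continuum.ShellMeasureScaling` — the SCALING ENGINE for the smooth member of the NE7c shell-measure frame:
# (M1) `T4ShellMeasure.SlotAntiConcentration` for a density model from ONE global contraction, with NO window
# condition and the constant `2·(dim E + B_f)/(1 − δ)` (cell `pub-balaban`, sub-cell `t4`, spine estimate NE7c
# (node U5b), lineage t4-ne7c-p1 = PROVER seat P1 «shell-measure route», generation 19; tree target
# `Summits/QuantumFields/BalabanUV/T4Continuum/Support/`; ADDITIVE — imports the Literature leaf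
# `T4ShellMeasureAnalytic` ONLY and modifies nothing)

HONEST FRAMING.  Finite four-torus programme, rung (B)+1 only — NOT infinite volume, NOT a mass gap, NOT the Clay
problem, NOT summit progress; (B), `BetaPertHyp`, (B^μ) are not mentioned because nothing here consumes them.  The
cell wall of NE7c — (M1) `T4ShellMeasure.SlotAntiConcentration` FOR BAŁABAN'S INDUCTIVELY DEFINED EFFECTIVE MEASURES —
is NOT PRINTED in [Balaban 1983–89] (GAPS G-ne7cp1-1, record `t4/T4-EST-NE7c-P1.md` §4), asserted by nobody, and NOT
moved by this file: the located inputs of the smooth member ((AN)/(NLR⁻) ray decay of the tested variable below the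
threshold, (DC-fwd) forward log-Lipschitz RAY WEIGHT, the chart / centre / (Det) / mass-ratio readings) keep their
status.  What changes is the ENGINE that turns those inputs into (M1), and one binder disappears.  Every declaration is
[folklore] kernel mathematics, 0 sorry, 0 citations (nothing printed is transcribed).

THE POINT.  The tree derives (M1) for a density model `μ.withDensity f` on a finite-dimensional configuration space by
DISINTEGRATION along dilation orbits (`T4ShellMeasureFibre.lintegral_shell_le_core`, `T4ShellMeasureAnalytic` §2,
`T4ShellMeasurePolar.slotAntiConcentration_withDensity`): the shell trace on each orbit is compared with a core segment
up to parameter distance `L` ahead of it, which costs the factor `fibreCoef δ B ℓ₀ L = 2e^{B(L/(1+δ)+ℓ₀/(1−δ))}/((1−δ)(…))`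
with `B = dim E + B_f` (polar Jacobian `e^{−(dim E)·r}` + ray weight), needs the WINDOW CONDITION
`0 < L/(1+δ) − ℓ₀/(1−δ)` and is linear in `B` only while `B·ℓ₀ ≤ (1−δ)/2` («admissible width», a ledger-level binder of
the member, record §3 (γ_loc)); at the admissible window the constant is `4B·e^{1+2Bℓ₀/(1−δ)}/(1−δ) ≤ 4e²B/(1−δ)`.
THIS FILE compares instead the whole sub-threshold event `A = {u < θ}` with its image under ONE linear contraction `T`
(the global dilation by `e^{−a}`, `a = −log(1−ρ)/(1−δ)`): if the contraction sends `A ∩ {f ≠ 0}` into the core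
`{u < θ(1−ρ)}` and loses at most the factor `M` on the density, then `|det T|·ν(A) ≤ M·ν(core)` by the change of
variables for the additive Haar measure (`core_ge_of_contraction`), hence
`ν(shell) ≤ (1 − |det T|/M)·ν(A)` (`shell_le_of_contraction`) — for the dilation `1 − e^{−(dim E + B_f)a} ≤ (dim E + B_f)·a`,
i.e. (M1) with `D = 2(dim E + B_f)/(1 − δ)` for every `ρ ≤ 1/2` (`slotAntiConcentration_of_rayDecay`), from the SAME
binder shapes as the tree's members (`slotAntiConcentration_of_decayBelow`: `T4ShellMeasureFibre.DecayBelow` of the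
log-profile along the ray + `T4ShellMeasureAnalytic.FwdLogLipschitzOn` of the ray weight on the forward ray) but with
NO window `L`, NO onset `s`, NO admissibility relation between `B` and `ℓ₀`, NO transversal proxy, no disintegration,
no measurability of polar maps.  The polar Jacobian enters EXACTLY (as `|det T| = e^{−(dim E)a}`), not through a
log-Lipschitz constant, which is why the exponential of `fibreCoef` disappears; the bound `1 − |det T|/M` is ATTAINED
(`shell_eq_of_cube`: Lebesgue measure on the unit sup-norm ball of `ℝ^{n+1}`, `u = ‖·‖_∞`, shell fraction exactly
`1 − (1−ρ)^{n+1}`), so the engine is optimal and the dimension factor in `D` is not an artefact.  Two-speed (toron-band)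
and blockwise variants are the same theorem with another `T` (`|det T| = e^{−(n_fl + n_h/2)a}`), not typed here.

WHAT THIS DOES TO THE MEMBER'S LEDGER (record §3, (γ_loc)/(Det) «WHAT (γ_loc) STILL BINDS»): the admissible-width binder
`ρ_j·B ≤ (1−δ)/4` is DELETED (the bound holds for every `ρ_j ≤ 1/2`); the slot constant improves from
`D_s = (8e²/(1−δ))·B` to `D_s = (4/(1−δ))·B` (mass ratio `M = 2` included; factor `2e² ≈ 14.8`); everything else —
(Det), (CH), (AN)/(FI-sat), (LR), (DC-loc)'s `B_f`, (MR), (W1), the (F∞)-rate — is UNCHANGED and NOT PRINTED.  The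
downstream consumers (`T4ShellMeasureLocal.slotAntiConcentration_of_sections`, `T4ShellMeasureDet.…_realized_of_sections`,
`T4ShellMeasure.slot_field_of_antiConcentration`, `T4ShellMeasureLevels`) consume `SlotAntiConcentration` BY NAME and are
indifferent to which engine produced it.
-/

namespace Summit.QuantumFields.BalabanUV.T4Continuum.ShellMeasureScaling

open MeasureTheory Set
open scoped ENNReal
open Literature.MathematicalPhysics.QuantumFieldTheory.Balaban1983to89
open T4ShellMeasure (SlotAntiConcentration)
open T4ShellMeasureFibre (DecayBelow neg_log_one_sub_le)
open T4ShellMeasureAnalytic (FwdLogLipschitzOn)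

section Engine

variable {E : Type*} [NormedAddCommGroup E] [NormedSpace ℝ E] [MeasurableSpace E] [BorelSpace E]
  [FiniteDimensional ℝ E] (μ : Measure E) [μ.IsAddHaarMeasure]

/-- Change of variables for the lower Lebesgue integral under a linear map of nonzero determinant:
`∫ g(Tx) dμ(x) = |det T|⁻¹ ∫ g dμ` for an additive Haar measure `μ`. [folklore] -/
theorem lintegral_comp_linearMap (g : E → ℝ≥0∞) {T : E →ₗ[ℝ] E} (hT : LinearMap.det T ≠ 0) :
    ∫⁻ x, g (T x) ∂μ = ENNReal.ofReal |(LinearMap.det T)⁻¹| * ∫⁻ x, g x ∂μ := by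
  have h := lintegral_map_equiv g
    (T.equivOfDetNeZero hT).toContinuousLinearEquiv.toHomeomorph.toMeasurableEquiv (μ := μ)
  calc ∫⁻ x, g (T x) ∂μ
      = ∫⁻ x, g ((T.equivOfDetNeZero hT).toContinuousLinearEquiv.toHomeomorph.toMeasurableEquiv x) ∂μ := rfl
    _ = ∫⁻ y, g y ∂(Measure.map
          ((T.equivOfDetNeZero hT).toContinuousLinearEquiv.toHomeomorph.toMeasurableEquiv) μ) := h.symm
    _ = ∫⁻ y, g y ∂(Measure.map T μ) := rfl
    _ = ENNReal.ofReal |(LinearMap.det T)⁻¹| * ∫⁻ x, g x ∂μ := by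
        rw [Measure.map_linearMap_addHaar_eq_smul_addHaar μ hT, lintegral_smul_measure, smul_eq_mul]

/-- **CORE LOWER BOUND BY ONE CONTRACTION.**  Density model `ν = μ.withDensity f` on a finite-dimensional real space
with additive Haar measure `μ`; `T` linear with `det T ≠ 0`; threshold `θ`, core level `lo`.  HYPOTHESIS (pointwise,
only on the support): every sub-threshold point `x` (`u x < θ`) with `f x ≠ 0` is sent by `T` into the core
(`u (T x) < lo`) with density loss at most `M` (`f x ≤ M · f (T x)`).  CONCLUSION: `|det T| · ν{u < θ} ≤ M · ν{u < lo}`.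
Proof: `𝟙_A·f ≤ M·(𝟙_C·f) ∘ T` pointwise and `∫ (𝟙_C f)∘T dμ = |det T|⁻¹ ν(C)`.  (No measurability of `f` is needed;
`u` measurable makes the two events measurable.) [folklore] -/
theorem core_ge_of_contraction {f : E → ℝ≥0∞} {u : E → ℝ} (hu : Measurable u)
    {T : E →ₗ[ℝ] E} (hT : LinearMap.det T ≠ 0) {θ lo M : ℝ}
    (H : ∀ x, u x < θ → f x ≠ 0 → u (T x) < lo ∧ f x ≤ ENNReal.ofReal M * f (T x)) :
    ENNReal.ofReal |LinearMap.det T| * (μ.withDensity f) {x | u x < θ} ≤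
      ENNReal.ofReal M * (μ.withDensity f) {x | u x < lo} := by
  have hA : MeasurableSet {x | u x < θ} := measurableSet_lt hu measurable_const
  have hC : MeasurableSet {x | u x < lo} := measurableSet_lt hu measurable_const
  have hTm : Measurable (fun x => T x) := (LinearMap.continuous_of_finiteDimensional T).measurable
  rw [withDensity_apply _ hA, withDensity_apply _ hC, ← lintegral_indicator hA, ← lintegral_indicator hC]
  -- pointwise domination
  have hpt : ∀ x, {x | u x < θ}.indicator f x ≤
      ENNReal.ofReal M * ({x | u x < lo}.indicator f) (T x) := by
    intro x
    by_cases hx : u x < θ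
    · by_cases hfx : f x = 0
      · simp [indicator, hx, hfx]
      · obtain ⟨h1, h2⟩ := H x hx hfx
        rw [indicator_of_mem (show x ∈ {x | u x < θ} from hx),
          indicator_of_mem (show T x ∈ {x | u x < lo} from h1)]
        exact h2
    · simp [indicator, hx]
  have h1 : ∫⁻ x, {x | u x < θ}.indicator f x ∂μ ≤
      ENNReal.ofReal M * (ENNReal.ofReal |(LinearMap.det T)⁻¹| * ∫⁻ x, {x | u x < lo}.indicator f x ∂μ) := by
    calc ∫⁻ x, {x | u x < θ}.indicator f x ∂μ
        ≤ ∫⁻ x, ENNReal.ofReal M * ({x | u x < lo}.indicator f) (T x) ∂μ := lintegral_mono hpt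
      _ = ENNReal.ofReal M * ∫⁻ x, ({x | u x < lo}.indicator f) (T x) ∂μ := by
          rw [lintegral_const_mul' _ _ ENNReal.ofReal_ne_top]
      _ = _ := by rw [lintegral_comp_linearMap μ _ hT]
  have hdet : 0 < |LinearMap.det T| := abs_pos.2 hT
  have hinv : ENNReal.ofReal |LinearMap.det T| * ENNReal.ofReal |(LinearMap.det T)⁻¹| = 1 := by
    rw [← ENNReal.ofReal_mul hdet.le, abs_inv, mul_inv_cancel₀ hdet.ne', ENNReal.ofReal_one]
  calc ENNReal.ofReal |LinearMap.det T| * ∫⁻ x, {x | u x < θ}.indicator f x ∂μ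
      ≤ ENNReal.ofReal |LinearMap.det T| * (ENNReal.ofReal M *
          (ENNReal.ofReal |(LinearMap.det T)⁻¹| * ∫⁻ x, {x | u x < lo}.indicator f x ∂μ)) :=
        mul_le_mul_right h1 _
    _ = ENNReal.ofReal M * ((ENNReal.ofReal |LinearMap.det T| * ENNReal.ofReal |(LinearMap.det T)⁻¹|) *
          ∫⁻ x, {x | u x < lo}.indicator f x ∂μ) := by ring
    _ = ENNReal.ofReal M * ∫⁻ x, {x | u x < lo}.indicator f x ∂μ := by rw [hinv, one_mul]

/-- **SHELL BOUND BY ONE CONTRACTION.**  Under the hypothesis of `core_ge_of_contraction` with `M > 0`, `lo ≤ θ` and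
finite sub-threshold mass, the shell `{lo ≤ u < θ}` carries at most the fraction `1 − |det T|/M` of the sub-threshold
mass (truncated at `0`).  SHARP: `shell_eq_of_cube`. [folklore] -/
theorem shell_le_of_contraction {f : E → ℝ≥0∞} {u : E → ℝ} (hu : Measurable u)
    {T : E →ₗ[ℝ] E} (hT : LinearMap.det T ≠ 0) {θ lo M : ℝ} (hM : 0 < M) (hlo : lo ≤ θ)
    (hfin : (μ.withDensity f) {x | u x < θ} ≠ ∞)
    (H : ∀ x, u x < θ → f x ≠ 0 → u (T x) < lo ∧ f x ≤ ENNReal.ofReal M * f (T x)) :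
    (μ.withDensity f) {x | lo ≤ u x ∧ u x < θ} ≤
      ENNReal.ofReal (1 - |LinearMap.det T| / M) * (μ.withDensity f) {x | u x < θ} := by
  set ν := μ.withDensity f with hν
  have hC : MeasurableSet {x | u x < lo} := measurableSet_lt hu measurable_const
  have hCA : {x | u x < lo} ⊆ {x | u x < θ} := fun x (hx : u x < lo) => lt_of_lt_of_le hx hlo
  have hS : {x | lo ≤ u x ∧ u x < θ} = {x | u x < θ} \ {x | u x < lo} := by
    ext x; simp only [mem_setOf_eq, mem_sdiff, not_lt]; tauto
  have hCfin : ν {x | u x < lo} ≠ ∞ := ne_top_of_le_ne_top hfin (measure_mono hCA)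
  rw [hS, measure_sdiff hCA hC.nullMeasurableSet hCfin]
  -- the core bound, divided by M
  have hcore := core_ge_of_contraction μ hu hT H
  have hq0 : 0 ≤ |LinearMap.det T| / M := div_nonneg (abs_nonneg _) hM.le
  have hge : ENNReal.ofReal (|LinearMap.det T| / M) * ν {x | u x < θ} ≤ ν {x | u x < lo} := by
    have hM' : ENNReal.ofReal M ≠ 0 := by rwa [Ne, ENNReal.ofReal_eq_zero, not_le]
    have h2 : ENNReal.ofReal (|LinearMap.det T| / M) = ENNReal.ofReal M⁻¹ * ENNReal.ofReal |LinearMap.det T| := by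
      rw [← ENNReal.ofReal_mul (inv_nonneg.2 hM.le), div_eq_inv_mul]
    rw [h2, mul_assoc]
    calc ENNReal.ofReal M⁻¹ * (ENNReal.ofReal |LinearMap.det T| * ν {x | u x < θ})
        ≤ ENNReal.ofReal M⁻¹ * (ENNReal.ofReal M * ν {x | u x < lo}) := mul_le_mul_right hcore _
      _ = ν {x | u x < lo} := by
          rw [← mul_assoc, ← ENNReal.ofReal_mul (inv_nonneg.2 hM.le), inv_mul_cancel₀ hM.ne',
            ENNReal.ofReal_one, one_mul]
  calc ν {x | u x < θ} - ν {x | u x < lo}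
      ≤ ν {x | u x < θ} - ENNReal.ofReal (|LinearMap.det T| / M) * ν {x | u x < θ} := tsub_le_tsub_left hge _
    _ = 1 * ν {x | u x < θ} - ENNReal.ofReal (|LinearMap.det T| / M) * ν {x | u x < θ} := by rw [one_mul]
    _ = (1 - ENNReal.ofReal (|LinearMap.det T| / M)) * ν {x | u x < θ} := by
        rw [ENNReal.sub_mul (fun _ _ => hfin)]
    _ ≤ ENNReal.ofReal (1 - |LinearMap.det T| / M) * ν {x | u x < θ} := by
        gcongr
        rw [← ENNReal.ofReal_one, ← ENNReal.ofReal_sub _ hq0]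

omit [MeasurableSpace E] [BorelSpace E] in
/-- The global dilation by `e^{−a}` as a linear map: determinant `e^{−(dim E)·a}`. [folklore] -/
theorem det_dilation (a : ℝ) :
    LinearMap.det (Real.exp (-a) • (LinearMap.id : E →ₗ[ℝ] E)) =
      Real.exp (-((Module.finrank ℝ E : ℝ) * a)) := by
  rw [LinearMap.det_smul, LinearMap.det_id, mul_one, ← Real.exp_nat_mul]; ring_nf

/-- **SHELL BOUND BY THE GLOBAL DILATION.**  If every sub-threshold point `x` of the support is sent by `x ↦ e^{−a}x`
(`a ≥ 0`) into the core `{u < lo}` with density loss at most `e^{B_f a}`, then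
`ν(shell) ≤ (1 − e^{−(dim E + B_f)a}) · ν{u < θ} ≤ (dim E + B_f)·a · ν{u < θ}` (finite sub-threshold mass; no sign condition on `a`, `B_f` is needed for the inequality). [folklore] -/
theorem shell_le_of_dilation {f : E → ℝ≥0∞} {u : E → ℝ} (hu : Measurable u)
    {θ lo a Bf : ℝ} (hlo : lo ≤ θ)
    (hfin : (μ.withDensity f) {x | u x < θ} ≠ ∞)
    (H : ∀ x, u x < θ → f x ≠ 0 →
      u (Real.exp (-a) • x) < lo ∧ f x ≤ ENNReal.ofReal (Real.exp (Bf * a)) * f (Real.exp (-a) • x)) :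
    (μ.withDensity f) {x | lo ≤ u x ∧ u x < θ} ≤
      ENNReal.ofReal ((Module.finrank ℝ E + Bf) * a) * (μ.withDensity f) {x | u x < θ} := by
  set T : E →ₗ[ℝ] E := Real.exp (-a) • LinearMap.id with hTdef
  have hTx : ∀ x, T x = Real.exp (-a) • x := fun x => by simp [hTdef]
  have hdetT : LinearMap.det T = Real.exp (-((Module.finrank ℝ E : ℝ) * a)) := det_dilation a
  have hT : LinearMap.det T ≠ 0 := by rw [hdetT]; exact (Real.exp_pos _).ne'
  have H' : ∀ x, u x < θ → f x ≠ 0 → u (T x) < lo ∧ f x ≤ ENNReal.ofReal (Real.exp (Bf * a)) * f (T x) := by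
    intro x hx hfx; rw [hTx]; exact H x hx hfx
  have h := shell_le_of_contraction μ hu hT (Real.exp_pos (Bf * a)) hlo hfin H'
  refine h.trans (mul_le_mul_of_nonneg_right (ENNReal.ofReal_le_ofReal ?_) bot_le)
  rw [hdetT, abs_of_pos (Real.exp_pos _), ← Real.exp_sub]
  have e1 : -((Module.finrank ℝ E : ℝ) * a) - Bf * a = -((Module.finrank ℝ E + Bf) * a) := by ring
  rw [e1]
  linarith [Real.add_one_le_exp (-((Module.finrank ℝ E + Bf) * a))]

/-- **(M1) FROM RAY DECAY — THE HEADLINE.**  Density model `ν = μ.withDensity f` (finite) on a finite-dimensional real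
space `E` with additive Haar measure `μ`; tested variable `u` measurable; threshold `θ > 0`; relative width
`0 ≤ ρ ≤ 1/2`; defect `δ < 1`; ray-weight constant `B_f ≥ 0`.  HYPOTHESES, pointwise on the support and only below the
threshold, for the ONE dilation depth `a = −log(1−ρ)/(1−δ)`: (NLR⁻) `u(e^{−a}x) ≤ e^{−(1−δ)a}·u(x)` (forward decay at
rate `≥ 1 − δ`) and (DC-fwd) `f(x) ≤ e^{B_f a}·f(e^{−a}x)` (forward log-Lipschitz RAY WEIGHT — the polar Jacobian is NOT
part of `B_f`).  CONCLUSION: `SlotAntiConcentration ν u θ ρ (2·(dim E + B_f)/(1 − δ))`.  No window, no onset, no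
admissibility relation between `dim E + B_f` and `ρ`. [folklore] -/
theorem slotAntiConcentration_of_rayDecay {f : E → ℝ≥0∞} [IsFiniteMeasure (μ.withDensity f)]
    {u : E → ℝ} (hu : Measurable u)
    {δ Bf θ ρ : ℝ} (hδ : δ < 1) (hBf : 0 ≤ Bf) (hθ : 0 < θ) (hρ0 : 0 ≤ ρ) (hρ2 : ρ ≤ 1 / 2)
    (hdec : ∀ x, u x < θ → f x ≠ 0 →
      u (Real.exp (-(-Real.log (1 - ρ) / (1 - δ))) • x) ≤
        Real.exp (-((1 - δ) * (-Real.log (1 - ρ) / (1 - δ)))) * u x)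
    (hden : ∀ x, u x < θ → f x ≠ 0 →
      f x ≤ ENNReal.ofReal (Real.exp (Bf * (-Real.log (1 - ρ) / (1 - δ)))) *
        f (Real.exp (-(-Real.log (1 - ρ) / (1 - δ))) • x)) :
    SlotAntiConcentration (μ.withDensity f) u θ ρ (2 * (Module.finrank ℝ E + Bf) / (1 - δ)) := by
  set ℓ₀ := -Real.log (1 - ρ) with hℓ₀
  set a := ℓ₀ / (1 - δ) with ha
  have h1δ : 0 < 1 - δ := by linarith
  have h1ρ : 0 < 1 - ρ := by linarith
  have hℓ₀0 : 0 ≤ ℓ₀ := T4ShellMeasureFibre.neg_log_one_sub_nonneg hρ0 (by linarith)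
  have ha0 : 0 ≤ a := div_nonneg hℓ₀0 h1δ.le
  have hexp : Real.exp (-((1 - δ) * a)) = 1 - ρ := by
    rw [ha, mul_div_cancel₀ _ h1δ.ne', hℓ₀, neg_neg, Real.exp_log h1ρ]
  -- the pointwise hypothesis of `shell_le_of_dilation` with `lo = θ(1 − ρ)`
  have H : ∀ x, u x < θ → f x ≠ 0 →
      u (Real.exp (-a) • x) < θ * (1 - ρ) ∧
        f x ≤ ENNReal.ofReal (Real.exp (Bf * a)) * f (Real.exp (-a) • x) := by
    intro x hx hfx
    refine ⟨?_, hden x hx hfx⟩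
    have h1 := hdec x hx hfx
    rw [hexp] at h1
    calc u (Real.exp (-a) • x) ≤ (1 - ρ) * u x := h1
      _ < (1 - ρ) * θ := by
          rcases eq_or_lt_of_le hρ2 with h | h
          · exact mul_lt_mul_of_pos_left hx h1ρ
          · exact mul_lt_mul_of_pos_left hx h1ρ
      _ = θ * (1 - ρ) := mul_comm _ _
  have hlo : θ * (1 - ρ) ≤ θ := by nlinarith
  have hfin : (μ.withDensity f) {x | u x < θ} ≠ ∞ := measure_ne_top _ _
  have h := shell_le_of_dilation μ hu hlo hfin H
  unfold SlotAntiConcentration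
  refine h.trans ?_
  calc ENNReal.ofReal ((Module.finrank ℝ E + Bf) * a) * (μ.withDensity f) {x | u x < θ}
      ≤ ENNReal.ofReal ((Module.finrank ℝ E + Bf) * a) * (μ.withDensity f) univ :=
        mul_le_mul_right (measure_mono (subset_univ _)) _
    _ ≤ ENNReal.ofReal (2 * (Module.finrank ℝ E + Bf) / (1 - δ) * ρ) * (μ.withDensity f) univ := by
        refine mul_le_mul_of_nonneg_right (ENNReal.ofReal_le_ofReal ?_) bot_le
        have hn : (0 : ℝ) ≤ Module.finrank ℝ E + Bf := by positivity
        have hℓ : ℓ₀ ≤ 2 * ρ := neg_log_one_sub_le hρ0 hρ2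
        calc (Module.finrank ℝ E + Bf) * a = (Module.finrank ℝ E + Bf) / (1 - δ) * ℓ₀ := by
              rw [ha]; field_simp
          _ ≤ (Module.finrank ℝ E + Bf) / (1 - δ) * (2 * ρ) :=
              mul_le_mul_of_nonneg_left hℓ (div_nonneg hn h1δ.le)
          _ = 2 * (Module.finrank ℝ E + Bf) / (1 - δ) * ρ := by ring

/-- **(M1) FROM THE TREE'S BINDER SHAPES, MINUS THE WINDOW.**  Same conclusion from: positivity of `u`;
`T4ShellMeasureFibre.DecayBelow` (defect `δ`, level `log θ`) of the log-profile `r ↦ log u(e^{−r}x)` along the ray from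
every point of the support (the one-sided half of the (NLR)/(AN) binder `hg` of the fibred members); and
`T4ShellMeasureAnalytic.FwdLogLipschitzOn` with constant `B_f` of the RAY WEIGHT `r ↦ f(e^{−r}x)` on the forward ray
`[0, ∞)` from every sub-threshold point of the support (the (DC-fwd) binder `hFwd` WITHOUT the polar factor and without a
window).  Compare `T4ShellMeasurePolar.slotAntiConcentration_withDensity`: there `B = dim E + B_f`, a window `L` with
`0 < L/(1+δ) − ℓ₀/(1−δ)` and the constant `2·fibreCoef δ B ℓ₀ L`; here `2(dim E + B_f)/(1 − δ)` and nothing else.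
[folklore] -/
theorem slotAntiConcentration_of_decayBelow {f : E → ℝ≥0∞} [IsFiniteMeasure (μ.withDensity f)]
    {u : E → ℝ} (hu : Measurable u) (hpos : ∀ x, 0 < u x)
    {δ Bf θ ρ : ℝ} (hδ : δ < 1) (hBf : 0 ≤ Bf) (hθ : 0 < θ) (hρ0 : 0 ≤ ρ) (hρ2 : ρ ≤ 1 / 2)
    (hdec : ∀ x, f x ≠ 0 → DecayBelow (fun r => Real.log (u (Real.exp (-r) • x))) δ (Real.log θ))
    (hden : ∀ x, u x < θ → f x ≠ 0 → FwdLogLipschitzOn (fun r => f (Real.exp (-r) • x)) Bf (Ici 0)) :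
    SlotAntiConcentration (μ.withDensity f) u θ ρ (2 * (Module.finrank ℝ E + Bf) / (1 - δ)) := by
  have h1δ : 0 < 1 - δ := by linarith
  have ha0 : 0 ≤ -Real.log (1 - ρ) / (1 - δ) :=
    div_nonneg (T4ShellMeasureFibre.neg_log_one_sub_nonneg hρ0 (by linarith)) h1δ.le
  refine slotAntiConcentration_of_rayDecay μ hu hδ hBf hθ hρ0 hρ2 ?_ ?_
  · intro x hx hfx
    set a := -Real.log (1 - ρ) / (1 - δ)
    have h := hdec x hfx (show (0 : ℝ) ≤ a from ha0)
      (by simpa only [neg_zero, Real.exp_zero, one_smul] using Real.log_lt_log (hpos x) hx)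
    -- h : (1 - δ) * (a - 0) ≤ log u(x) - log u(e^{-a} x)
    simp only [sub_zero, neg_zero, Real.exp_zero, one_smul] at h
    have hux := hpos (Real.exp (-a) • x)
    rw [← Real.log_le_log_iff hux (mul_pos (Real.exp_pos _) (hpos x)), Real.log_mul (Real.exp_pos _).ne'
      (hpos x).ne', Real.log_exp]
    linarith
  · intro x hx hfx
    set a := -Real.log (1 - ρ) / (1 - δ)
    have h := hden x hx hfx (Set.mem_Ici.2 le_rfl) (Set.mem_Ici.2 ha0) ha0
    simpa only [sub_zero, neg_zero, Real.exp_zero, one_smul] using h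

/-- **THE EXACT CASE.**  `u` positively homogeneous of degree one (`u(cx) = c·u(x)`, `0 < c`) and `f` non-increasing
along rays from the origin (`f(x) ≤ f(cx)` for `0 < c ≤ 1` — e.g. a radially non-increasing small-field weight times
monotone co-tests): `SlotAntiConcentration ν u θ ρ (2·dim E)` for every `ρ ≤ 1/2`.  (`δ = 0`, `B_f = 0`.) [folklore] -/
theorem slotAntiConcentration_of_homogeneous {f : E → ℝ≥0∞} [IsFiniteMeasure (μ.withDensity f)]
    {u : E → ℝ} (hu : Measurable u)
    (hhom : ∀ (c : ℝ) (x : E), 0 < c → u (c • x) = c * u x)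
    (hmono : ∀ (c : ℝ) (x : E), 0 < c → c ≤ 1 → f x ≤ f (c • x))
    {θ ρ : ℝ} (hθ : 0 < θ) (hρ0 : 0 ≤ ρ) (hρ2 : ρ ≤ 1 / 2) :
    SlotAntiConcentration (μ.withDensity f) u θ ρ (2 * Module.finrank ℝ E) := by
  have h := slotAntiConcentration_of_rayDecay μ (f := f) hu (δ := 0) (Bf := 0) (by norm_num) le_rfl hθ hρ0 hρ2
    (fun x _ _ => by rw [hhom _ _ (Real.exp_pos _), sub_zero, one_mul])
    (fun x _ _ => by
      rw [zero_mul, Real.exp_zero, ENNReal.ofReal_one, one_mul]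
      exact hmono _ _ (Real.exp_pos _) (by
        rw [Real.exp_le_one_iff, neg_nonpos]
        exact div_nonneg (T4ShellMeasureFibre.neg_log_one_sub_nonneg hρ0 (by linarith)) (by norm_num)))
  simpa only [add_zero, sub_zero, div_one] using h

end Engine

/-! ## Sharpness: the sup-norm cube -/

section Cube

/-- **THE ENGINE IS SHARP.**  On `ℝ^{n+1}` with the sup norm, Lebesgue measure restricted to the unit ball
(`f = 𝟙_{‖x‖ < 1}`) and `u = ‖·‖`, `θ = 1`: the shell `{1 − ρ ≤ ‖x‖ < 1}` carries EXACTLY the fraction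
`1 − (1 − ρ)^{n+1}` of the mass — the bound `1 − |det T|/M` of `shell_le_of_contraction` with `T = (1 − ρ)·id`, `M = 1`
is attained, and `(n+1)·ρ` is its first-order size: the dimension factor in (M1)'s constant is not an artefact of the
method. [folklore] -/
theorem shell_eq_of_cube (n : ℕ) {ρ : ℝ} (hρ0 : 0 ≤ ρ) (hρ1 : ρ < 1) :
    ((volume : Measure (Fin (n + 1) → ℝ)).withDensity ((Metric.ball (0 : Fin (n + 1) → ℝ) 1).indicator 1))
        {x | 1 * (1 - ρ) ≤ ‖x‖ ∧ ‖x‖ < 1} =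
      ENNReal.ofReal (1 - (1 - ρ) ^ (n + 1)) *
        ((volume : Measure (Fin (n + 1) → ℝ)).withDensity
          ((Metric.ball (0 : Fin (n + 1) → ℝ) 1).indicator 1)) univ := by
  have h1ρ : 0 < 1 - ρ := by linarith
  rw [withDensity_indicator_one Metric.isOpen_ball.measurableSet, Measure.restrict_apply_univ,
    Measure.restrict_apply' Metric.isOpen_ball.measurableSet]
  have hS : {x : Fin (n + 1) → ℝ | 1 * (1 - ρ) ≤ ‖x‖ ∧ ‖x‖ < 1} ∩ Metric.ball 0 1 =
      Metric.ball 0 1 \ Metric.ball 0 (1 - ρ) := by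
    ext x
    simp only [one_mul, mem_inter_iff, mem_setOf_eq, Metric.mem_ball, dist_zero_right, mem_sdiff, not_lt]
    tauto
  rw [hS, measure_sdiff (Metric.ball_subset_ball (by linarith)) Metric.isOpen_ball.measurableSet.nullMeasurableSet
    (by rw [Real.volume_pi_ball _ h1ρ]; exact ENNReal.ofReal_ne_top),
    Real.volume_pi_ball _ h1ρ, Real.volume_pi_ball _ one_pos, Fintype.card_fin]
  have h2 : (0 : ℝ) ≤ (2 * (1 - ρ)) ^ (n + 1) := by positivity
  have h3 : (0 : ℝ) ≤ 1 - (1 - ρ) ^ (n + 1) := by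
    have : (1 - ρ) ^ (n + 1) ≤ 1 := pow_le_one₀ h1ρ.le (by linarith)
    linarith
  rw [← ENNReal.ofReal_sub _ h2, ← ENNReal.ofReal_mul h3]
  congr 1
  rw [mul_pow, mul_pow, one_pow]; ring

/-- **NON-VACUITY OF THE HEADLINE ON THE SAME CUBE.**  The sup norm is positively homogeneous and the indicator of the
unit ball is non-increasing along rays, so `slotAntiConcentration_of_homogeneous` applies: the cube model satisfies
`SlotAntiConcentration ν ‖·‖ 1 ρ (2(n+1))` for every `ρ ≤ 1/2` — against the exact fraction `1 − (1−ρ)^{n+1} ≤ (n+1)ρ`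
of `shell_eq_of_cube` (the factor `2` is the price of `−log(1−ρ) ≤ 2ρ` on `[0, 1/2]`). [folklore] -/
theorem slotAntiConcentration_cube (n : ℕ) {ρ : ℝ} (hρ0 : 0 ≤ ρ) (hρ2 : ρ ≤ 1 / 2) :
    SlotAntiConcentration
      ((volume : Measure (Fin (n + 1) → ℝ)).withDensity ((Metric.ball (0 : Fin (n + 1) → ℝ) 1).indicator 1))
      (fun x => ‖x‖) 1 ρ (2 * (n + 1)) := by
  haveI : IsFiniteMeasure ((volume : Measure (Fin (n + 1) → ℝ)).withDensity
      ((Metric.ball (0 : Fin (n + 1) → ℝ) 1).indicator 1)) := by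
    rw [withDensity_indicator_one Metric.isOpen_ball.measurableSet]
    exact isFiniteMeasure_restrict.2 measure_ball_lt_top.ne
  have h := slotAntiConcentration_of_homogeneous (volume : Measure (Fin (n + 1) → ℝ))
    (f := (Metric.ball (0 : Fin (n + 1) → ℝ) 1).indicator 1) (u := fun x => ‖x‖) measurable_norm
    (fun c x hc => by simp only [norm_smul, Real.norm_eq_abs, abs_of_pos hc])
    (fun c x hc hc1 => by
      by_cases hx : x ∈ Metric.ball (0 : Fin (n + 1) → ℝ) 1
      · have hcx : c • x ∈ Metric.ball (0 : Fin (n + 1) → ℝ) 1 := by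
          rw [Metric.mem_ball, dist_zero_right] at hx ⊢
          rw [norm_smul, Real.norm_eq_abs, abs_of_pos hc]
          nlinarith [norm_nonneg x]
        rw [indicator_of_mem hx, indicator_of_mem hcx, Pi.one_apply, Pi.one_apply]
      · rw [indicator_of_notMem hx]; exact bot_le)
    one_pos hρ0 hρ2
  simpa only [Module.finrank_fintype_fun_eq_card, Fintype.card_fin, Nat.cast_add, Nat.cast_one] using h

end Cube

end Summit.QuantumFields.BalabanUV.T4Continuum.ShellMeasureScaling
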